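import Literature.NumberTheory.LFunctions.RealZeroEffectiveRepulsionExplicitII
import Literature.NumberTheory.LFunctions.HeckeLOneLowerBoundExplicit
import Literature.NumberTheory.DiophantineGeometry.NamedHypothesesRHProofs
import Literature.Barriers.Parity.SiegelZeroDichotomy
import Mathlib.Analysis.SpecialFunctions.Pow.Real
import HarnessLib

/-!
# The Deuring phenomenon with an explicit constant (Stopple 2012): a zero `ρ = β + iγ` of `ζ`
# with `β > 7/8` forces `L(1, χ) > 1/(5400 · U^{12(1−β)} · log³U)`, `U = |ρ| D^{1/4} log D`, for
# every real primitive `χ` mod `D ≡ 0 (4)`, `D > 10⁹` — AS PRINTED, plus PROVED readings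

Topic `Literature/NumberTheory/LFunctions` (namespace `Literature.NumberTheory.LFunctions`; readings in
the grouping sub-namespace `Stopple2012`). STATEMENT LAYER (D-0014) typed for the cell
`parity-realchar` (SIEGEL INSTRUMENT, conditionals column: «Deuring–Heilbronn repulsion in its explicit
forms»; topic family I.8 explicit Deuring–Heilbronn / I.10 Deuring's vertical phenomenon «low zeros of
`ζ` under an exceptional real character» — theory's topic-vs-source call). ONE named fact, everything
else PROVED.

Source: J. Stopple, *Elementary Deuring–Heilbronn phenomenon*, Acta Arith. **156** (2012) 283–291
[Stopple2012ElementaryDH]. READ on the held arXiv text (arXiv:1201.0713, `paper:arxiv-1201.0713`,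
§1 «Introduction», the Theorem; §§2–5 the proof; §6 «The general case»); the journal pagination was
NOT diffed (journal copy not held) — disclosed. Abstract: "Adapting a technique of Pintz, we give an
elementary demonstration of the Deuring phenomenon: a zero of `ζ(s)` off the critical line gives a
lower bound on `L(1, χ)`. The necessary tools are Dirichlet's method of the hyperbola, Euler
summation, summation by parts, and the Pólya–Vinogradov inequality."

## What the source prints (§1)

"Suppose `ρ = β + iγ` is a zero of `ζ(s)` off the critical line. Let `δ/2π` be the fractional part of
`log 2 · γ/2π` so that for integer `n`, `log 2 · γ = 2πn + δ`, `−π < δ ≤ π`, `2^{−iγ} = exp(−iδ)`.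
**Theorem.** If `β > 7/8` and `|δ| > π/100`, then for any real primitive character `χ` modulo
`D ≡ 0 mod 4`, `D > 10⁹`, we have the lower bound `L(1, χ) > 1/(5400 · U^{12(1−β)} log³U)`, where
`U = |ρ| D^{1/4} log D`." ("The proof actually gives some kind of nontrivial bound as long as
`β > 5/6`. We assume `β > 7/8` simply to get a precise constant in the theorem. In the last section we
discuss general `D`" — §6 treats `q ∣ D` via Ramanujan sums `c_q(n)` WITHOUT a printed constant: "the
constant `1/25` in Lemma 1 which works for `q = 2` is a decreasing function of `q` in the general case";
only the `D ≡ 0 (4)` theorem is typed.)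

## How it is typed

* `ρ`: any `ρ : ℂ` with `riemannZeta ρ = 0` and `7/8 < Re ρ` (then `ρ` is automatically a non-trivial
  zero off the critical line; `Re ρ < 1` by Mathlib's non-vanishing on `Re s ≥ 1`). `|ρ|` = `‖ρ‖`.
* `|δ| > π/100`: `δ` is the representative of `γ log 2` modulo `2π` in `(−π, π]`, so the condition says
  `dist(γ log 2, 2πℤ) > π/100`; rendered `∀ n : ℤ, π/100 < |Im ρ · log 2 − 2πn|` (equivalent).
* "real primitive character `χ` modulo `D ≡ 0 mod 4`": `χ : DirichletCharacter ℂ D`, `χ.IsPrimitive`,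
  `χ.IsQuadratic` (a real primitive character mod `D > 1` is quadratic), `D % 4 = 0`, `10⁹ < D`;
  `L(1,χ)` is real and the bound is stated on `Re L(1,χ)`.
* `U^{12(1−β)}` is the real power `Real.rpow`; `log³U = (log U)³`.
* [NUM-INPUT] PROOF INPUT DISCLOSED (not part of the statement): the proof uses X. Gourdon's numerical
  verification of RH for the first `10¹³` zeros (web report, 2004; spelled «Gourdan» in the source's
  bibliography) to ensure `|ρ| > 2.4·10¹²` and `U > 10¹⁶` (§2
  Lemma 2, §5); the refereed substitute is Platt–Trudgian, Bull. LMS 53 (2021) Thm 1 (`RH` to height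
  `3·10¹²`; tree: the named hypothesis `DiophantineGeometry.RiemannHypothesisUpTo`), and the tree PROVES
  `RiemannHypothesisUpTo 10⁵` unconditionally (`riemannHypothesisUpTo_100000`). The reading
  `Stopple2012.lt_abs_im_of_zero` records what any `RiemannHypothesisUpTo T` says about the `ρ` of the
  hypothesis (`|γ| > T`).

## Contents

* `stopple2012_theorem` — NAMED FACT, the Theorem AS PRINTED (unproved here).
* PROVED: `Stopple2012.one_lt_U` (`U > 1` under the hypotheses, so the printed bound is a positive
  number); `Stopple2012.quality_lt_of_zeta_zero` — on the column's predicate: if `χ` mod `D ≡ 0 (4)`,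
  `D > 10⁹`, carries a Tao–Teräväinen Siegel zero of quality `η ≥ 40`, then every zero `ρ` of `ζ` with
  `Re ρ > 7/8` and `|δ| > π/100` has `η < 5400 · log D · U^{12(1−β)} · log³U` (kernel (11.10):
  `‖L(1,χ)‖ log D ≤ (log D)²/η`); `Stopple2012.riemannZeta_ne_zero_of_isSiegelZero` — the same as a
  ZERO-FREE REGION for `ζ` («Deuring's phenomenon»): under such a Siegel zero, `ζ(ρ) ≠ 0` whenever
  `Re ρ > 7/8`, `|δ| > π/100` and `5400 · log D · U^{12(1−Re ρ)} · log³U ≤ η` — the larger the quality,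
  the higher up `ζ`'s hypothetical off-line zeros with `β > 7/8` are pushed;
  `Stopple2012.lt_abs_im_of_zero` — under `RiemannHypothesisUpTo T` every `ρ` of the hypothesis has
  `|Im ρ| > T` (conjugation symmetry and `ζ(σ) ≠ 0` on `0 < σ < 1`).

presearch: «elementary Deuring–Heilbronn / Stopple 2012» → corpus: held arXiv:1201.0713 (this source);
LS HARVEST: only Stopple 2013 (Acta Arith. 157, P-113, 1-level density, not typed) and Stopple's
Conrey–Iwaniec notes; tree `lean search Stopple|stopple2012` → none on this paper (the tree's Stopple
references are Lehmer pairs / theta). Not a restatement of any tree declaration: the tree's explicit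
DH facts (`BGTZ2025.*`, `thornerZaman2024_theorem215`, `jutila1977_theorem2`, `heathBrown1992_theorem4`)
repel zeros of the SAME family `𝓛_q`/of `L(s,χ)`, and Watkins 2021 (`Watkins2021.DeuringSpacing`) is a
PRED without printed constants; this is the explicit `ζ`-versus-`L(1,χ)` (Deuring) form.

LABEL (cell rule): instrument / statement layer. WHAT THIS IS NOT: no claim that `ζ` has a zero off the
critical line or that an exceptional character exists (under RH the fact is vacuous; under
`NoSiegelZeros` the readings are vacuous); nothing here bears on the parity summit. No instances, no
notation, no axioms.

## References

* [Stopple2012ElementaryDH] J. Stopple, Acta Arith. 156 (2012), no. 3, 283–291 = arXiv:1201.0713: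
  §1 Theorem (typed), §2 Lemma 1, §3 Lemma 2, §5, §6 (general `D`, index only).
* [TaoTeravainen2021] T. Tao, J. Teräväinen, JLMS 106 (2022), Definition 1.4 (`IsSiegelZero`).
* [MontgomeryVaughan2007] Theorem 11.4 (11.10) (kernel version `RealZeroRepulsion.isSiegelZero_eta_le_log_sq_div`).
* [Titchmarsh1986] §2.12 (conjugate zeros; no real zeros of `ζ` in `(0,1)`), as proved in the tree.
-/

noncomputable section

open Complex
open Literature.Barriers.Parity
open Literature.NumberTheory.DiophantineGeometry

namespace Literature.NumberTheory.LFunctions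

/-- **Stopple 2012, Theorem (NAMED FACT, AS PRINTED; §1 of the source).** "If `β > 7/8` and
`|δ| > π/100`, then for any real primitive character `χ` modulo `D ≡ 0 mod 4`, `D > 10⁹`, we have the
lower bound `L(1, χ) > 1/(5400 · U^{12(1−β)} log³U)`, where `U = |ρ| D^{1/4} log D`" — `ρ = β + iγ` a
zero of `ζ(s)` (off the critical line), `δ ∈ (−π, π]` the representative of `γ log 2` modulo `2π`.
Rendered: for every `ρ` with `ζ(ρ) = 0`, `Re ρ > 7/8`, `dist(Im ρ · log 2, 2πℤ) > π/100`, every `D` with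
`4 ∣ D`, `D > 10⁹`, and every primitive quadratic `χ` mod `D`:
`1/(5400 · U^{12(1 − Re ρ)} · (log U)³) < Re L(1,χ)`, `U = ‖ρ‖ · D^{1/4} · log D`. Not proved here
(Pintz's method for `φ(s) = (2^{1−s} − 1)ζ(s)`: hyperbola method, Euler summation, partial summation,
Pólya–Vinogradov; the proof also invokes a numerical RH verification `|γ| > 2.4·10¹²`, see the module
docstring). [cite: Stopple2012ElementaryDH, Theorem (§1)] -/
def stopple2012_theorem : Prop :=
  ∀ ρ : ℂ, riemannZeta ρ = 0 → 7 / 8 < ρ.re →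
    (∀ n : ℤ, Real.pi / 100 < |ρ.im * Real.log 2 - 2 * Real.pi * n|) →
    ∀ (D : ℕ) [NeZero D], D % 4 = 0 → 10 ^ 9 < D →
      ∀ χ : DirichletCharacter ℂ D, χ.IsPrimitive → χ.IsQuadratic →
        1 / (5400 * (‖ρ‖ * (D : ℝ) ^ (1 / 4 : ℝ) * Real.log D) ^ (12 * (1 - ρ.re)) *
              Real.log (‖ρ‖ * (D : ℝ) ^ (1 / 4 : ℝ) * Real.log D) ^ 3) < (χ.LFunction 1).re

namespace Stopple2012

/-! ### The size of `U` -/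

/-- Under the hypotheses of the Theorem, `U = ‖ρ‖ D^{1/4} log D > 1` (indeed `‖ρ‖ > 7/8`, `D^{1/4} ≥ 1`,
`log D > 20`), so `U^{12(1−β)} > 0`, `log U > 0` and the printed bound is a positive number.
[cite: Stopple2012ElementaryDH, Theorem (§1)] -/
theorem one_lt_U {ρ : ℂ} (hβ : 7 / 8 < ρ.re) {D : ℕ} (hD : 10 ^ 9 < D) :
    1 < ‖ρ‖ * (D : ℝ) ^ (1 / 4 : ℝ) * Real.log D := by
  have hρ : 7 / 8 < ‖ρ‖ := lt_of_lt_of_le hβ (Complex.re_le_norm ρ)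
  have hD1 : (1 : ℝ) ≤ D := by exact_mod_cast (show 1 ≤ D by omega)
  have hD9 : (10 : ℝ) ^ 9 < D := by exact_mod_cast hD
  have hpow : (1 : ℝ) ≤ (D : ℝ) ^ (1 / 4 : ℝ) := Real.one_le_rpow hD1 (by norm_num)
  -- `log D > 2`: `exp 2 < 9 < D`
  have hlog : 2 < Real.log D := by
    rw [Real.lt_log_iff_exp_lt (by linarith)]
    have h := Real.exp_one_lt_d9
    have : Real.exp 2 = Real.exp 1 * Real.exp 1 := by rw [← Real.exp_add]; norm_num
    nlinarith [Real.exp_pos 1]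
  calc (1 : ℝ) < 7 / 8 * 1 * 2 := by norm_num
    _ ≤ ‖ρ‖ * (D : ℝ) ^ (1 / 4 : ℝ) * Real.log D := by
        have h1 : 7 / 8 * 1 ≤ ‖ρ‖ * (D : ℝ) ^ (1 / 4 : ℝ) :=
          mul_le_mul hρ.le hpow (by norm_num) (norm_nonneg _)
        exact mul_le_mul h1 hlog.le (by norm_num) (by positivity)

/-- Positivity of the printed denominator `5400 · U^{12(1−β)} · log³U`.
[cite: Stopple2012ElementaryDH, Theorem (§1)] -/
theorem denominator_pos {ρ : ℂ} (hβ : 7 / 8 < ρ.re) {D : ℕ} (hD : 10 ^ 9 < D) :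
    0 < 5400 * (‖ρ‖ * (D : ℝ) ^ (1 / 4 : ℝ) * Real.log D) ^ (12 * (1 - ρ.re)) *
      Real.log (‖ρ‖ * (D : ℝ) ^ (1 / 4 : ℝ) * Real.log D) ^ 3 := by
  have hU := one_lt_U hβ hD
  have h1 : 0 < (‖ρ‖ * (D : ℝ) ^ (1 / 4 : ℝ) * Real.log D) ^ (12 * (1 - ρ.re)) :=
    Real.rpow_pos_of_pos (by linarith) _
  have h2 : 0 < Real.log (‖ρ‖ * (D : ℝ) ^ (1 / 4 : ℝ) * Real.log D) := Real.log_pos hU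
  positivity

/-! ### Readings on the column's predicate -/

/-- **A Siegel zero bounds its own quality by the position of any off-line zero of `ζ`** (PROVED
modulo the named fact). If `χ` mod `D ≡ 0 (4)`, `D > 10⁹`, carries a Tao–Teräväinen Siegel zero of
quality `η ≥ 40` (`χ` primitive quadratic, `L(1 − 1/(η log D), χ) = 0`), then for every zero `ρ` of
`ζ` with `Re ρ > 7/8` and `|δ| > π/100`: `η < 5400 · log D · U^{12(1 − Re ρ)} · (log U)³`,
`U = ‖ρ‖ D^{1/4} log D` — by the Theorem and the kernel's explicit (11.10),
`‖L(1,χ)‖ · log D ≤ (log D)²/η`. [cite: Stopple2012ElementaryDH, Theorem (§1)]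
[cite: TaoTeravainen2021, Definition 1.4] -/
theorem quality_lt_of_zeta_zero (h : stopple2012_theorem) {D : ℕ} [NeZero D] (h4 : D % 4 = 0)
    (hD : 10 ^ 9 < D) {χ : DirichletCharacter ℂ D} {η : ℝ} (hS : IsSiegelZero χ η) (h40 : 40 ≤ η)
    {ρ : ℂ} (hz : riemannZeta ρ = 0) (hβ : 7 / 8 < ρ.re)
    (hδ : ∀ n : ℤ, Real.pi / 100 < |ρ.im * Real.log 2 - 2 * Real.pi * n|) :
    η < 5400 * Real.log D * (‖ρ‖ * (D : ℝ) ^ (1 / 4 : ℝ) * Real.log D) ^ (12 * (1 - ρ.re)) *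
      Real.log (‖ρ‖ * (D : ℝ) ^ (1 / 4 : ℝ) * Real.log D) ^ 3 := by
  set X := 5400 * (‖ρ‖ * (D : ℝ) ^ (1 / 4 : ℝ) * Real.log D) ^ (12 * (1 - ρ.re)) *
      Real.log (‖ρ‖ * (D : ℝ) ^ (1 / 4 : ℝ) * Real.log D) ^ 3 with hX
  have hX0 : 0 < X := denominator_pos hβ hD
  have hmain : 1 / X < (χ.LFunction 1).re := h ρ hz hβ hδ D h4 hD χ hS.1 hS.2.1
  have hq : 232 ≤ D := by omega
  have hη : 0 < η := by linarith
  have hlog : 0 < Real.log D := Real.log_pos (by exact_mod_cast (show 1 < D by omega))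
  have hkey := RealZeroRepulsion.isSiegelZero_eta_le_log_sq_div hq hS h40
  -- `Re L(1) ≤ ‖L(1)‖ ≤ log D/η`
  have hnorm : ‖χ.LFunction 1‖ ≤ Real.log D / η := by
    rw [le_div_iff₀ hη]
    refine le_of_mul_le_mul_right ?_ hlog
    have := mul_le_mul_of_nonneg_right hkey hη.le
    rw [div_mul_cancel₀ _ hη.ne'] at this
    nlinarith
  have hre : 1 / X < Real.log D / η :=
    lt_of_lt_of_le hmain ((Complex.re_le_norm _).trans hnorm)
  -- `1/X < log D/η` ⇒ `η < log D · X`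
  rw [div_lt_div_iff₀ hX0 hη, one_mul] at hre
  calc η < Real.log D * X := hre
    _ = _ := by rw [hX]; ring

/-- **Deuring's phenomenon, explicit (PROVED modulo the named fact): a Siegel zero of large quality
makes `ζ` zero-free low down off the line.** Under a Siegel zero of quality `η ≥ 40` at a primitive
quadratic `χ` mod `D ≡ 0 (4)`, `D > 10⁹`: `ζ(ρ) ≠ 0` for every `ρ` with `Re ρ > 7/8`, `|δ| > π/100`
and `5400 · log D · U^{12(1 − Re ρ)} · (log U)³ ≤ η` (`U = ‖ρ‖ D^{1/4} log D`).
[cite: Stopple2012ElementaryDH, Theorem (§1)] [cite: TaoTeravainen2021, Definition 1.4] -/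
theorem riemannZeta_ne_zero_of_isSiegelZero (h : stopple2012_theorem) {D : ℕ} [NeZero D]
    (h4 : D % 4 = 0) (hD : 10 ^ 9 < D) {χ : DirichletCharacter ℂ D} {η : ℝ}
    (hS : IsSiegelZero χ η) (h40 : 40 ≤ η) {ρ : ℂ} (hβ : 7 / 8 < ρ.re)
    (hδ : ∀ n : ℤ, Real.pi / 100 < |ρ.im * Real.log 2 - 2 * Real.pi * n|)
    (hsmall : 5400 * Real.log D * (‖ρ‖ * (D : ℝ) ^ (1 / 4 : ℝ) * Real.log D) ^ (12 * (1 - ρ.re)) *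
      Real.log (‖ρ‖ * (D : ℝ) ^ (1 / 4 : ℝ) * Real.log D) ^ 3 ≤ η) :
    riemannZeta ρ ≠ 0 :=
  fun hz => absurd hsmall (not_le.mpr (quality_lt_of_zeta_zero h h4 hD hS h40 hz hβ hδ))

/-! ### What a numerical RH verification says about the `ρ` of the hypothesis -/

/-- **The zeros in the hypothesis live above any verified height** (PROVED): if RH holds up to
height `T` (`RiemannHypothesisUpTo T`: kernel for `T = 10⁵`, `riemannHypothesisUpTo_100000`; named for
Platt–Trudgian's `T = 3·10¹²`), then every zero `ρ` of `ζ` with `Re ρ > 7/8` has `|Im ρ| > T`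
(`Im ρ = 0` is impossible: `ζ(σ) ≠ 0` for `0 < σ < 1` and for `σ ≥ 1`; for `0 < |Im ρ| ≤ T` the
verification and conjugation symmetry put `ρ` on the critical line). This is the shape of the
source's use of Gourdan's computation (`|ρ| > 2.4·10¹²`). [cite: Stopple2012ElementaryDH, §5 (use of the RH verification)]
[cite: Titchmarsh1986, §2.12 (text after (2.12.4))] -/
theorem lt_abs_im_of_zero {T : ℝ} (hRH : RiemannHypothesisUpTo T) {ρ : ℂ} (hz : riemannZeta ρ = 0)
    (hβ : 7 / 8 < ρ.re) : T < |ρ.im| := by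
  have hre1 : ρ.re < 1 := by
    by_contra hge
    exact riemannZeta_ne_zero_of_one_le_re (not_lt.mp hge) hz
  have him : ρ.im ≠ 0 := im_ne_zero_of_riemannZeta_eq_zero hz (by linarith) hre1
  by_contra hle
  have hle' : |ρ.im| ≤ T := not_lt.mp hle
  rcases lt_or_gt_of_ne him with hneg | hpos
  · have := hRH.re_eq_of_im_neg hz hneg (by rw [abs_of_neg hneg] at hle'; exact hle')
    linarith
  · have := hRH ρ hz hpos (by rw [abs_of_pos hpos] at hle'; exact hle')
    linarith

/-! ### Appended 2026-08-27 (rc-cond g10): on the certified range the Deuring floor is DOMINATED —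
the Direction-III link of the column (kernel; PROVED only, debt 0)

Under the wide criterion `NoRealZeroUpTo Q` the kernel Hecke lemma
(`Hecke.lOne_ge_eighth_of_noRealZeroUpTo`) gives `L(1,χ) ≥ 1/(8 log D)` for every primitive quadratic `χ`
mod `D`, `10⁴ ≤ D ≤ Q`; and the printed floor `1/(5400 · U^{12(1−β)} · log³U)` is `< 64/(5400 (log D)³)
< 1/(8 log D)` for every zero `ρ` of `ζ` with `Re ρ > 7/8` (`U ≥ D^{1/4}`, `U^{12(1−β)} ≥ 1` as `β < 1`).
So for the booked conductors the Theorem's conclusion holds with NO hypothesis on `δ`, `D mod 4` or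
`D > 10⁹`: the illusory content of the fact lives entirely above the table. -/

/-- `U ≥ D^{1/4} > 1` already for `D ≥ 10⁴` (`‖ρ‖ log D ≥ (7/8)·9 > 1`). [cite: Stopple2012ElementaryDH, Theorem (§1)] -/
private theorem rpow_quarter_le_U {ρ : ℂ} (hβ : 7 / 8 < ρ.re) {D : ℕ} (hD : 10 ^ 4 ≤ D) :
    (D : ℝ) ^ (1 / 4 : ℝ) ≤ ‖ρ‖ * (D : ℝ) ^ (1 / 4 : ℝ) * Real.log D := by
  have hρ : 7 / 8 < ‖ρ‖ := lt_of_lt_of_le hβ (Complex.re_le_norm ρ)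
  have hD' : (10 : ℝ) ^ 4 ≤ D := by exact_mod_cast hD
  have hlog : 9 ≤ Real.log D := by
    rw [Real.le_log_iff_exp_le (by linarith)]
    have h1 : Real.exp 9 = Real.exp 1 ^ 9 := by rw [← Real.exp_nat_mul]; norm_num
    rw [h1]
    calc Real.exp 1 ^ 9 ≤ 2.7182818286 ^ 9 :=
          pow_le_pow_left₀ (Real.exp_pos 1).le Real.exp_one_lt_d9.le 9
      _ ≤ (10 : ℝ) ^ 4 := by norm_num
      _ ≤ D := hD'
  have hpow : 0 ≤ (D : ℝ) ^ (1 / 4 : ℝ) := Real.rpow_nonneg (by positivity) _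
  have h1 : 1 ≤ ‖ρ‖ * Real.log D := by nlinarith
  calc (D : ℝ) ^ (1 / 4 : ℝ) = 1 * (D : ℝ) ^ (1 / 4 : ℝ) := by ring
    _ ≤ (‖ρ‖ * Real.log D) * (D : ℝ) ^ (1 / 4 : ℝ) := mul_le_mul_of_nonneg_right h1 hpow
    _ = ‖ρ‖ * (D : ℝ) ^ (1 / 4 : ℝ) * Real.log D := by ring

/-- **On the certified range the printed floor is below the kernel Hecke floor** (PROVED, fact-free):
under `NoRealZeroUpTo Q`, for every primitive quadratic `χ` mod `D` with `10⁴ ≤ D ≤ Q` and every zero `ρ` of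
`ζ` with `Re ρ > 7/8` (no condition on `δ`, on `D mod 4`, or `D > 10⁹`):
`1/(5400 · U^{12(1 − Re ρ)} · (log U)³) < Re L(1,χ)` — because `Re L(1,χ) ≥ 1/(8 log D)` (kernel Hecke
lemma on the table) and `5400 · U^{12(1−β)} · (log U)³ ≥ 5400 (log D/4)³ > 8 log D`. The Theorem's content
is thus void of information for the booked conductors; it speaks about `D > Q` only.
[cite: Stopple2012ElementaryDH, Theorem (§1)] [cite: Platt2016GRH, Theorems 7.1 and 7.2] -/
theorem conclusion_of_noRealZeroUpTo {Q : ℕ} (hW : NoRealZeroUpTo Q) {D : ℕ} [NeZero D]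
    (hD : 10 ^ 4 ≤ D) (hDQ : D ≤ Q) {χ : DirichletCharacter ℂ D} (hprim : χ.IsPrimitive)
    (hquad : χ.IsQuadratic) {ρ : ℂ} (hz : riemannZeta ρ = 0) (hβ : 7 / 8 < ρ.re) :
    1 / (5400 * (‖ρ‖ * (D : ℝ) ^ (1 / 4 : ℝ) * Real.log D) ^ (12 * (1 - ρ.re)) *
          Real.log (‖ρ‖ * (D : ℝ) ^ (1 / 4 : ℝ) * Real.log D) ^ 3) < (χ.LFunction 1).re := by
  set U := ‖ρ‖ * (D : ℝ) ^ (1 / 4 : ℝ) * Real.log D with hU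
  have hre1 : ρ.re < 1 := by
    by_contra hge
    exact riemannZeta_ne_zero_of_one_le_re (not_lt.mp hge) hz
  have hD' : (10 : ℝ) ^ 4 ≤ D := by exact_mod_cast hD
  have hD0 : (0 : ℝ) < D := by linarith
  have hlogD : 9 ≤ Real.log D := by
    rw [Real.le_log_iff_exp_le hD0]
    have h1 : Real.exp 9 = Real.exp 1 ^ 9 := by rw [← Real.exp_nat_mul]; norm_num
    rw [h1]
    calc Real.exp 1 ^ 9 ≤ 2.7182818286 ^ 9 :=
          pow_le_pow_left₀ (Real.exp_pos 1).le Real.exp_one_lt_d9.le 9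
      _ ≤ (10 : ℝ) ^ 4 := by norm_num
      _ ≤ D := hD'
  -- `U ≥ D^{1/4} > 1`, `log U ≥ (log D)/4`
  have hUge : (D : ℝ) ^ (1 / 4 : ℝ) ≤ U := rpow_quarter_le_U hβ hD
  have hD4pos : 0 < (D : ℝ) ^ (1 / 4 : ℝ) := Real.rpow_pos_of_pos hD0 _
  have hU1 : 1 < U := lt_of_lt_of_le (Real.one_lt_rpow (by linarith) (by norm_num)) hUge
  have hlogU : Real.log D / 4 ≤ Real.log U := by
    have h := Real.log_le_log hD4pos hUge
    rwa [Real.log_rpow hD0, show (1 / 4 : ℝ) * Real.log D = Real.log D / 4 by ring] at h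
  have hlogU0 : 0 < Real.log U := Real.log_pos hU1
  -- `U^{12(1−β)} ≥ 1`
  have hpow1 : 1 ≤ U ^ (12 * (1 - ρ.re)) := Real.one_le_rpow hU1.le (by linarith)
  -- the Hecke floor on the table
  have hH := Hecke.lOne_ge_eighth_of_noRealZeroUpTo χ hW hD hDQ hprim hquad
  have hlogD0 : 0 < Real.log D := by linarith
  -- `5400 · U^{12(1−β)} · (log U)^3 ≥ 5400 (log D/4)^3 > 8 log D`
  have hX : 8 * Real.log D < 5400 * U ^ (12 * (1 - ρ.re)) * Real.log U ^ 3 := by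
    have h3 : (Real.log D / 4) ^ 3 ≤ Real.log U ^ 3 :=
      pow_le_pow_left₀ (by positivity) hlogU 3
    have h4 : Real.log U ^ 3 ≤ U ^ (12 * (1 - ρ.re)) * Real.log U ^ 3 := by
      have := mul_le_mul_of_nonneg_right hpow1 (pow_nonneg hlogU0.le 3)
      linarith
    have h5 : 8 * Real.log D < 5400 * (Real.log D / 4) ^ 3 := by
      have hsq : 81 ≤ Real.log D ^ 2 := by nlinarith
      have : 5400 * (Real.log D / 4) ^ 3 = (5400 / 64) * Real.log D ^ 2 * Real.log D := by ring
      rw [this]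
      nlinarith
    nlinarith
  have hXpos : 0 < 5400 * U ^ (12 * (1 - ρ.re)) * Real.log U ^ 3 := by positivity
  calc 1 / (5400 * U ^ (12 * (1 - ρ.re)) * Real.log U ^ 3) < 1 / (8 * Real.log D) :=
        one_div_lt_one_div_of_lt (by positivity) hX
    _ ≤ (χ.LFunction 1).re := hH

/-- Decade instance (`Q = 10¹⁰`, two-lineage booked leaf `NoRealZeroUpTo_1e10`).
[cite: Stopple2012ElementaryDH, Theorem (§1)] [cite: Platt2016GRH, Theorems 7.1 and 7.2] -/
theorem conclusion_upTo_1e10_of_leaf (hW : NoRealZeroUpTo_1e10) {D : ℕ} [NeZero D]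
    (hD : 10 ^ 4 ≤ D) (hDQ : D ≤ 10 ^ 10) {χ : DirichletCharacter ℂ D} (hprim : χ.IsPrimitive)
    (hquad : χ.IsQuadratic) {ρ : ℂ} (hz : riemannZeta ρ = 0) (hβ : 7 / 8 < ρ.re) :
    1 / (5400 * (‖ρ‖ * (D : ℝ) ^ (1 / 4 : ℝ) * Real.log D) ^ (12 * (1 - ρ.re)) *
          Real.log (‖ρ‖ * (D : ℝ) ^ (1 / 4 : ℝ) * Real.log D) ^ 3) < (χ.LFunction 1).re :=
  conclusion_of_noRealZeroUpTo hW hD (by norm_num at hDQ ⊢; exact hDQ) hprim hquad hz hβ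

/-- Instance at `3·10¹⁰` (leaf `NoRealZeroUpTo_3e10` = routes F ∧ G; value-free until both book).
[cite: Stopple2012ElementaryDH, Theorem (§1)] [cite: Platt2016GRH, Theorems 7.1 and 7.2] -/
theorem conclusion_upTo_3e10_of_leaf (hW : NoRealZeroUpTo_3e10) {D : ℕ} [NeZero D]
    (hD : 10 ^ 4 ≤ D) (hDQ : D ≤ 3 * 10 ^ 10) {χ : DirichletCharacter ℂ D} (hprim : χ.IsPrimitive)
    (hquad : χ.IsQuadratic) {ρ : ℂ} (hz : riemannZeta ρ = 0) (hβ : 7 / 8 < ρ.re) :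
    1 / (5400 * (‖ρ‖ * (D : ℝ) ^ (1 / 4 : ℝ) * Real.log D) ^ (12 * (1 - ρ.re)) *
          Real.log (‖ρ‖ * (D : ℝ) ^ (1 / 4 : ℝ) * Real.log D) ^ 3) < (χ.LFunction 1).re :=
  conclusion_of_noRealZeroUpTo hW hD (by norm_num at hDQ ⊢; exact hDQ) hprim hquad hz hβ

end Stopple2012

end Literature.NumberTheory.LFunctions

end
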